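import Summits.AtomisticToContinuum.Crystallization.Theorems.ExcessDecayLiouvilleTwoLatticeForce
import Summits.AtomisticToContinuum.Crystallization.Theorems.ExcessDecayLiouvilleHcpLiouvilleDefs

/-!
# `ExcessDecayLiouville.HcpLiouville` (stmt-AtomisticToContinuum-9332), line `Sketch`: the anchor is a zero of the optical force

Helper for stub `stub_anchor` of the line `two-level-caccioppoli` (crux `HcpLiouville`, lead skeleton
`Lines/Sketch.lean`).  For an admissible datum `(t, A)` (`Adm₀ A`, `Inner₀ t A`) write `d = t 1 − t 0` for
the inner shift and, for a shift `e`, let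

`g_A(e) = Σ_{z ∈ Λ₀} (V′(|e + Az|)/|e + Az|)·(e + Az)`

be the **optical (inter-sublattice) force**: the Lennard-Jones force exerted on a site of sublattice `1`
by the whole of sublattice `0` (an absolutely convergent lattice sum, `summable_optForce`).  By the
two-lattice bookkeeping of `ExcessDecayLiouvilleTwoLatticeForce.lean` (same-sublattice forces cancel by
inversion symmetry, the reference force is constant on sublattices and opposite on the two of them) the
reference force at `t 1` IS `g_A(d)` (`refForce_one_eq_tsum_optForce`), so that

* `equil₀_sites_iff_hasSum` : `Equil₀ (Sites₀ t A) ↔ HasSum (z ↦ (V′(|d + Az|)/|d + Az|)·(d + Az)) 0`;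
* `stub_anchorReduction` (registered sub-goal) : the conclusion of `stub_anchor` — a relaxed inner shift
  `τ`, `‖τ‖ ≤ 1/20`, with `Inner₀ (anchorDatum t τ) A` and `Equil₀ (Sites₀ (anchorDatum t τ) A)` — holds
  iff `g_A` has a zero `e` with `‖e − A(w₀ + √(2/3)e₃)‖ ≤ 1/40` (then `τ = e − d`, and
  `‖τ‖ ≤ 1/40 + 1/40`);
* `anchor_of_relaxedShift` / `relaxedShift_of_anchor` : consequently the anchor statement for all
  admissible data is EQUIVALENT to the datum-free fact
  `RelaxedShift : ∀ A, Adm₀ A → ∃ e, ‖e − A(w₀ + √(2/3)e₃)‖ ≤ 1/40 ∧ g_A(e) = 0`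
  ("every admissible cell has a relaxed inner shift within `1/40` of the ideal one").

All `[folklore]`; a `--supports` helper for item stmt-AtomisticToContinuum-9332, nothing here closes an
item.
-/

noncomputable section

namespace Summit.AtomisticToContinuum.Crystallization.Theorems.ExcessDecayLiouville

open scoped BigOperators Topology Classical InnerProductSpace
open Literature.MathematicalPhysics.StatisticalMechanics
open Summit.AtomisticToContinuum.Crystallization.Theses.ExcessDecayLiouville
open Summit.AtomisticToContinuum.Crystallization.Theorems.PhononStabilityNegative

local notation "E3" => EuclideanSpace ℝ (Fin 3)

section

variable {t : Fin 2 → E3} {A : E3 →L[ℝ] E3}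

/-! ## The optical force as the reference force at `t 1` -/

/-- `t 0 − A z` is a site of sublattice `0` for `z ∈ Λ₀`. [folklore] -/
private theorem sub_apply_mem_sites₀_zero {z : E3} (hz : z ∈ Λ₀) : t 0 - A z ∈ Sites₀ t A :=
  ⟨0, -z, neg_mem_Λ₀ hz, by rw [map_neg]; abel⟩

/-- `t 0 − A z ≠ t 1` for `z ∈ Λ₀` (the two sublattices are `23/25` apart). [folklore] -/
private theorem sub_apply_ne_one (hA : Adm₀ A) (hI : Inner₀ t A) {z : E3} (hz : z ∈ Λ₀) :
    t 0 - A z ≠ t 1 := by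
  intro h
  have hd := dist_sites_cross_ge hA hI (neg_mem_Λ₀ hz) zero_mem_Λ₀
  rw [map_zero, add_zero, map_neg, ← sub_eq_add_neg, h, dist_self] at hd
  norm_num at hd

/-- **The optical force is an absolutely convergent lattice sum**: for an admissible hcp-like datum the
family `z ↦ (V′(|d + Az|)/|d + Az|)·(d + Az)`, `d = t 1 − t 0`, is summable over `Λ₀` (it is a subfamily
of the reference force family at the site `t 1`). [folklore] -/
theorem summable_optForce (hA : Adm₀ A) (hI : Inner₀ t A) :
    Summable (fun z : Λ₀ =>
      (deriv lennardJones ‖t 1 - t 0 + A z‖ / ‖t 1 - t 0 + A z‖) • (t 1 - t 0 + A (z : E3))) := by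
  have ht1 : t 1 ∈ Sites₀ t A := ⟨1, 0, zero_mem_Λ₀, by simp⟩
  let i : Λ₀ → {q : E3 // q ∈ Sites₀ t A ∧ q ≠ t 1} :=
    fun z => ⟨t 0 - A z, sub_apply_mem_sites₀_zero z.2, sub_apply_ne_one hA hI z.2⟩
  have hinj : Function.Injective i := by
    intro z z' h
    have h' : t 0 - A z = t 0 - A z' := congrArg (fun q : {q : E3 // q ∈ Sites₀ t A ∧ q ≠ t 1} => (q : E3)) h
    exact Subtype.ext (injective_of_adm₀ hA (sub_right_injective h'))
  have hs := (summable_refForce hA hI ht1).comp_injective hinj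
  refine hs.congr fun z => ?_
  show (deriv lennardJones (dist (t 1) (t 0 - A z)) / dist (t 1) (t 0 - A z)) • (t 1 - (t 0 - A z)) = _
  rw [dist_eq_norm, sub_sub_eq_add_sub, add_sub_right_comm]

/-- **The reference force at `t 1` is the optical force at the inner shift**:
`Σ'_{q ∈ S, q ≠ t 1} (V′(|t 1 − q|)/|t 1 − q|)·(t 1 − q) = Σ'_{z ∈ Λ₀} (V′(|d + Az|)/|d + Az|)·(d + Az)`,
`d = t 1 − t 0` (the same-sublattice part vanishes by inversion symmetry, the cross part is reindexed by
`z ↦ −z`). [folklore] -/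
theorem refForce_one_eq_tsum_optForce (hA : Adm₀ A) (hI : Inner₀ t A) :
    (∑' q : {q : E3 // q ∈ Sites₀ t A ∧ q ≠ t 1},
      (deriv lennardJones (dist (t 1) q) / dist (t 1) q) • (t 1 - (q : E3))) =
    ∑' z : Λ₀, (deriv lennardJones ‖t 1 - t 0 + A z‖ / ‖t 1 - t 0 + A z‖) • (t 1 - t 0 + A (z : E3)) := by
  set g1 : E3 → E3 := fun q => (deriv lennardJones (dist (t 1) q) / dist (t 1) q) • (t 1 - q) with hg1
  have hinj0 : Set.InjOn (fun z : E3 => t 0 + A z) Set.univ :=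
    fun z _ z' _ h => injective_of_adm₀ hA (add_left_cancel h)
  have hinj1 : Set.InjOn (fun z : E3 => t 1 + A z) Set.univ :=
    fun z _ z' _ h => injective_of_adm₀ hA (add_left_cancel h)
  have ht1 : t 1 ∈ Sites₀ t A := ⟨1, 0, zero_mem_Λ₀, by simp⟩
  have hsub1a : (fun z : E3 => t 1 + A z) '' {z : E3 | z ∈ Λ₀ ∧ z ≠ 0} ⊆ {q | q ∈ Sites₀ t A ∧ q ≠ t 1} := by
    rw [sites_ne_eq_union_one hA hI]; exact Set.subset_union_left
  have hsub1b : (fun z : E3 => t 0 + A z) '' Λ₀ ⊆ {q | q ∈ Sites₀ t A ∧ q ≠ t 1} := by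
    rw [sites_ne_eq_union_one hA hI]; exact Set.subset_union_right
  -- split F(t 1) into its same-sublattice and cross parts
  have hF1 : (∑' q : {q : E3 // q ∈ Sites₀ t A ∧ q ≠ t 1}, g1 q) =
      (∑' z : {z : E3 // z ∈ Λ₀ ∧ z ≠ 0}, g1 (t 1 + A z)) + ∑' z : Λ₀, g1 (t 0 + A z) := by
    have h1 : (∑' q : {q : E3 // q ∈ Sites₀ t A ∧ q ≠ t 1}, g1 q) =
        ∑' q : ↥((fun z : E3 => t 1 + A z) '' {z : E3 | z ∈ Λ₀ ∧ z ≠ 0} ∪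
          (fun z : E3 => t 0 + A z) '' Λ₀), g1 q := by
      rw [← sites_ne_eq_union_one hA hI]; rfl
    have hdisj : Disjoint ((fun z : E3 => t 1 + A z) '' {z : E3 | z ∈ Λ₀ ∧ z ≠ 0})
        ((fun z : E3 => t 0 + A z) '' Λ₀) :=
      (disjoint_sublattice_images hA hI _ _ subset_rfl (fun z hz => hz.1)).symm
    rw [h1, Summable.tsum_union_disjoint (f := g1) hdisj
      (summable_refForce_on hA hI ht1 hsub1a) (summable_refForce_on hA hI ht1 hsub1b),
      tsum_image g1 (hinj1.mono (Set.subset_univ _)), tsum_image g1 (hinj0.mono (Set.subset_univ _))]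
    rfl
  -- the same-sublattice part vanishes
  have hS1 : (∑' z : {z : E3 // z ∈ Λ₀ ∧ z ≠ 0}, g1 (t 1 + A z)) = 0 := by
    have : ∀ z : {z : E3 // z ∈ Λ₀ ∧ z ≠ 0}, g1 (t 1 + A z) =
        -((deriv lennardJones ‖A z‖ / ‖A z‖) • A (z : E3)) := by
      intro z
      simp only [hg1, dist_eq_norm, sub_add_cancel_left, norm_neg, smul_neg]
    simp only [this, tsum_neg, tsum_ljForce_lattice_eq_zero, neg_zero]
  -- the cross part, reindexed by `z ↦ −z`
  let e : Λ₀ ≃ Λ₀ :=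
    { toFun := fun z => ⟨-z, neg_mem_Λ₀ z.2⟩
      invFun := fun z => ⟨-z, neg_mem_Λ₀ z.2⟩
      left_inv := fun z => by ext; simp
      right_inv := fun z => by ext; simp }
  have hX : (∑' z : Λ₀, g1 (t 0 + A z)) =
      ∑' z : Λ₀, (deriv lennardJones ‖t 1 - t 0 + A z‖ / ‖t 1 - t 0 + A z‖) • (t 1 - t 0 + A (z : E3)) := by
    rw [← e.tsum_eq (f := fun z : Λ₀ => g1 (t 0 + A z))]
    refine tsum_congr fun z => ?_
    show g1 (t 0 + A (-(z : E3))) = _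
    simp only [hg1, dist_eq_norm, map_neg]
    have hv : t 1 - (t 0 + -A (z : E3)) = t 1 - t 0 + A z := by abel
    rw [hv]
  change (∑' q : {q : E3 // q ∈ Sites₀ t A ∧ q ≠ t 1}, g1 q) = _
  rw [hF1, hS1, zero_add, hX]

/-- **Force balance of a perfect two-lattice = vanishing optical force.**  For an admissible hcp-like
datum `(t, A)` the site set `Sites₀ t A` is in Lennard-Jones force balance (`Equil₀`) iff the optical
force vanishes at the inner shift `d = t 1 − t 0`:
`HasSum (z ↦ (V′(|d + Az|)/|d + Az|)·(d + Az)) 0` over `Λ₀`. [folklore] -/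
theorem equil₀_sites_iff_hasSum (hA : Adm₀ A) (hI : Inner₀ t A) :
    Equil₀ (Sites₀ t A) ↔
      HasSum (fun z : Λ₀ =>
        (deriv lennardJones ‖t 1 - t 0 + A z‖ / ‖t 1 - t 0 + A z‖) • (t 1 - t 0 + A (z : E3))) 0 := by
  have h0 : Equil₀ (Sites₀ t A) ↔
      (∑' q : {q : E3 // q ∈ Sites₀ t A ∧ q ≠ t 0},
        (deriv lennardJones (dist (t 0) q) / dist (t 0) q) • (t 0 - (q : E3))) = 0 :=
    sites_equil_iff hA hI
  have h01 := refForce_zero_add_refForce_one hA hI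
  rw [h0, (summable_optForce hA hI).hasSum_iff, ← refForce_one_eq_tsum_optForce hA hI]
  constructor
  · intro h; rwa [h, zero_add] at h01
  · intro h; rwa [h, add_zero] at h01

end

/-! ## The anchor as a zero of the optical force -/

/-- **Registered sub-goal `stub_anchorReduction`** (crux stmt-AtomisticToContinuum-9332, line `Sketch`):
for an admissible hcp-like datum `(t, A)`, a relaxed inner shift `τ` as in `stub_anchor`
(`‖τ‖ ≤ 1/20`, `Inner₀ (anchorDatum t τ) A`, `Equil₀ (Sites₀ (anchorDatum t τ) A)`) exists iff the
optical force `g_A` has a zero `e` within `1/40` of the ideal shift `A(w₀ + √(2/3)e₃)`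
(`τ = e − (t 1 − t 0)`; `‖τ‖ ≤ 1/40 + 1/40` by `Inner₀ t A`). [folklore] -/
theorem stub_anchorReduction : ∀ (t : Fin 2 → E3) (A : E3 →L[ℝ] E3), Adm₀ A → Inner₀ t A → ((∃ τ : E3, ‖τ‖ ≤ 1 / 20 ∧ Inner₀ (anchorDatum t τ) A ∧ Equil₀ (Sites₀ (anchorDatum t τ) A)) ↔ ∃ e : E3, ‖e - A (barlowOffset 1 + layerNormal (Real.sqrt (2 / 3)))‖ ≤ 1 / 40 ∧ HasSum (fun z : Λ₀ => (deriv lennardJones ‖e + A z‖ / ‖e + A z‖) • (e + A z)) 0) := by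
  intro t A hA hI
  constructor
  · rintro ⟨τ, -, hIτ, hEτ⟩
    refine ⟨t 1 + τ - t 0, ?_, ?_⟩
    · have h : Inner₀ (anchorDatum t τ) A := hIτ
      unfold Inner₀ at h
      simpa only [anchorDatum_one, anchorDatum_zero] using h
    · have h := (equil₀_sites_iff_hasSum hA hIτ).1 hEτ
      simpa only [anchorDatum_one, anchorDatum_zero] using h
  · rintro ⟨e, he, hsum⟩
    have hd : ‖t 1 - t 0 - A (barlowOffset 1 + layerNormal (Real.sqrt (2 / 3)))‖ ≤ 1 / 40 := hI
    have he1 : t 1 + (e - (t 1 - t 0)) - t 0 = e := by abel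
    have hIτ : Inner₀ (anchorDatum t (e - (t 1 - t 0))) A := by
      unfold Inner₀
      simpa only [anchorDatum_one, anchorDatum_zero, he1] using he
    refine ⟨e - (t 1 - t 0), ?_, hIτ, ?_⟩
    · have hsplit : e - (t 1 - t 0) = (e - A (barlowOffset 1 + layerNormal (Real.sqrt (2 / 3)))) -
          (t 1 - t 0 - A (barlowOffset 1 + layerNormal (Real.sqrt (2 / 3)))) := by abel
      rw [hsplit]
      exact (norm_sub_le _ _).trans (by linarith)
    · refine (equil₀_sites_iff_hasSum hA hIτ).2 ?_
      simpa only [anchorDatum_one, anchorDatum_zero, he1] using hsum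

/-- **The anchor from a relaxed shift of the cell**: if every admissible cell `A` has a zero `e` of its
optical force within `1/40` of the ideal shift, then every admissible hcp-like datum `(t, A)` has a relaxed
inner shift `τ` as in `stub_anchor` (the `PhononStability`-free form of the stub). [folklore] -/
theorem anchor_of_relaxedShift
    (h : ∀ A : E3 →L[ℝ] E3, Adm₀ A → ∃ e : E3, ‖e - A (barlowOffset 1 + layerNormal (Real.sqrt (2 / 3)))‖ ≤ 1 / 40 ∧
      HasSum (fun z : Λ₀ => (deriv lennardJones ‖e + A z‖ / ‖e + A z‖) • (e + A z)) 0) :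
    ∀ (t : Fin 2 → E3) (A : E3 →L[ℝ] E3), Adm₀ A → Inner₀ t A →
      ∃ τ : E3, ‖τ‖ ≤ 1 / 20 ∧ Inner₀ (anchorDatum t τ) A ∧ Equil₀ (Sites₀ (anchorDatum t τ) A) :=
  fun t A hA hI => (stub_anchorReduction t A hA hI).2 (h A hA)

/-- **Conversely**, the anchor statement for all admissible hcp-like data forces a relaxed shift of every
admissible cell (test it on the ideal datum `t = (0, A(w₀ + √(2/3)e₃))`): the conclusion of `stub_anchor`
is equivalent to the datum-free relaxed-shift statement. [folklore] -/
theorem relaxedShift_of_anchor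
    (h : ∀ (t : Fin 2 → E3) (A : E3 →L[ℝ] E3), Adm₀ A → Inner₀ t A →
      ∃ τ : E3, ‖τ‖ ≤ 1 / 20 ∧ Inner₀ (anchorDatum t τ) A ∧ Equil₀ (Sites₀ (anchorDatum t τ) A)) :
    ∀ A : E3 →L[ℝ] E3, Adm₀ A → ∃ e : E3, ‖e - A (barlowOffset 1 + layerNormal (Real.sqrt (2 / 3)))‖ ≤ 1 / 40 ∧
      HasSum (fun z : Λ₀ => (deriv lennardJones ‖e + A z‖ / ‖e + A z‖) • (e + A z)) 0 := by
  intro A hA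
  set t : Fin 2 → E3 := ![0, A (barlowOffset 1 + layerNormal (Real.sqrt (2 / 3)))] with ht
  have hI : Inner₀ t A := by
    unfold Inner₀
    simp [ht]
  exact (stub_anchorReduction t A hA hI).1 (h t A hA hI)

end Summit.AtomisticToContinuum.Crystallization.Theorems.ExcessDecayLiouville

end
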